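import Literature.Combinatorics.Additive.DeZeeuwLineIntersectionBound
import Literature.Combinatorics.Extremal.RuledSurfaceCrossingBound
import Literature.Combinatorics.Extremal.FlecnodePolynomial
import Literature.Combinatorics.Extremal.LineIntersectionsOnSurface
import Literature.Combinatorics.Extremal.SubsetSampling
import Mathlib.Analysis.SpecialFunctions.Pow.Real
import HarnessLib

/-!
# The bipartite Guth–Katz line bound by the Guth–Katz induction (de Zeeuw 2016, Lemma 3.1)

Topic `Literature/Combinatorics/Additive`. Everything in this file is PROVED; there is no
hypothesis left: the file ends with `stevensDeZeeuw_thm4_holds`.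

F. de Zeeuw, *A short proof of Rudnev's point–plane incidence bound*, arXiv:1612.02719,
**Lemma 3.1**: for finite sets `L, M` of lines of `K³` (`K` algebraically closed), `|L| ≤ |M|`,
`|L| = O(p²)` in characteristic `p > 0`, and no quadric or plane containing `s` lines of `L`
and `t` lines of `M`, the number of points lying on a line of `L` and a line of `M` is
`O(|L|^{1/2}|M| + t|L| + s|M|)` (`lineIntersection_closed`, the hypothesis `H` of
`rudnev_pointPlaneIncidence_of_lineIntersection_closed`).

de Zeeuw's printed proof (formalized in `DeZeeuwLineIntersectionBound.lean` modulo the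
single-component bound `GKK`) uses, for the non-ruled components of the interpolating surface,
Kollár's `O(d³)` bound for the intersection points of lines on a non-ruled surface of degree
`d` [Kollar2015, Cor. 21], whose proof rests on the arithmetic genus of complete-intersection
curves. Here that input is replaced by **Guth–Katz's original induction on the number of lines
with degree reduction** [GuthKatz2015, §3–4 (proof of Proposition 2.? via "degree reduction"
and "optimality of the example")]: on a non-ruled component of degree `d` lie at most `39 d²`
lines (`card_lines_le_of_not_generically_ruled`, the elementary Monge–Salmon–Cayley theorem of
`FlecnodePolynomial.lean`), and when the interpolating polynomial has degree `D ≪ |L|^{1/2}`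
this is fewer lines than we started with, so the induction hypothesis applies. The degree
reduction (a polynomial of degree `D ≤ 243 |L|^{1/2}/C` vanishing on all lines of `L` carrying
at least `C|M|/(10|L|^{1/2})` points, except for a few) is obtained from a `k`-subset of `M`
chosen by the derandomized sampling lemma `exists_subset_few_small` (second moment +
averaging; failed rich lines are simply paid for), interpolation through the sample
(`exists_surface_through_lines`) and Bézout on each rich line.

The per-component analysis is that of [Kollar2015, §2 (20), Cor. 21] / de Zeeuw §3, with the
elementary structure theorem for ruled surfaces `crossing_bound_of_generically_ruled`
(at most two special lines; at most `d - 1` crossing points on any other line) in place of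
[Kollar2015, Prop. 55], cones (`card_le_one_of_cone`) and cylinders
(`card_eq_zero_of_cylinder`) apart:

* `card_sameComponent_le'`, `card_le_of_componentBound'` — de Zeeuw's component count
  (variants of the unprimed versions: the surface is GIVEN, of degree `≤ D`, and the
  component bound carries the linear term `t|L'| + s|M'|` and applies to sub-families only);
* `componentBound_of_induction` — the bound `244 C d³ + 3 (d|L'| + |M'|) + (t|L'| + s|M'|)` for
  the lines of `L, M` on one irreducible component of degree `3 ≤ d ≤ D`, from the induction
  hypothesis (non-ruled case) and the ruled-surface structure (ruled case);
* `lineIntersection_step` — the inductive step (trivial bound for `|L| ≤ C²`; otherwise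
  pruning of poor lines, sampling, degree reduction, component count);
* `lineIntersection_closed_explicit` — Lemma 3.1 with the explicit constant
  `C = 10⁵ (√c₀ + 1)`, by strong induction on `|L| + |M|`;
* `lineIntersection_closed` — the hypothesis `H`, and `stevensDeZeeuw_thm4_holds`.

## References
* [deZeeuw2016] F. de Zeeuw, arXiv:1612.02719 — Lemma 3.1 and its proof (§3).
* [GuthKatz2015] L. Guth, N. H. Katz, *On the Erdős distinct distances problem in the plane*,
  Ann. of Math. 181 (2015) 155–190 — §3 (ruled surfaces, degree reduction, induction).
* [Kollar2015] J. Kollár, *Szemerédi–Trotter-type theorems in dimension 3*, Adv. Math. 271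
  (2015) 30–61 — §2 (20), Cor. 21, Prop. 55, §7 (54).
* [StevensDeZeeuw2017] S. Stevens, F. de Zeeuw, Bull. LMS 49 (2017) — Theorem 4.
-/

namespace Literature.Combinatorics.Additive

open Finset MvPolynomial
open DeZeeuw
open Literature.Combinatorics.Extremal (translate)

/-! ### de Zeeuw's component count, for a given surface and a component bound with linear term -/

section ComponentCount

variable {K : Type*} [Field K]

open scoped Classical in
/-- **One component** (variant of `DeZeeuw.card_sameComponent_le`): the points whose two lines
are both assigned to the irreducible factor `g` number at most `s|M_g| + t|L_g|` if `deg g ≤ 2`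
(hypothesis on planes and quadrics) and at most
`C₁ deg(g)³ + C₂ (deg(g)|L_g| + |M_g|) + (t|L_g| + s|M_g|)` if `deg g ≥ 3` (the component
bound `hG`, assumed for sub-families of `L, M` and degrees `≤ D` only).
[cite: deZeeuw2016, Lemma 3.1 (proof, §3)] -/
theorem card_sameComponent_le' {C₁ C₂ : ℝ} (hC₁ : 0 ≤ C₁) (hC₂ : 0 ≤ C₂)
    (L M : Finset (AffineSubspace K (Fin 3 → K))) (s t D : ℕ)
    (hG : ∀ g : MvPolynomial (Fin 3) K, Irreducible g → 3 ≤ g.totalDegree →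
      g.totalDegree ≤ D →
      ∀ (L' M' : Finset (AffineSubspace K (Fin 3 → K))), L' ⊆ L → M' ⊆ M →
        (∀ ℓ ∈ L', ∀ z ∈ ℓ, eval z g = 0) → (∀ m ∈ M', ∀ z ∈ m, eval z g = 0) →
        ∀ I : Finset (Fin 3 → K), (∀ z ∈ I, (∃ ℓ ∈ L', z ∈ ℓ) ∧ (∃ m ∈ M', z ∈ m)) →
          (I.card : ℝ) ≤ C₁ * (g.totalDegree : ℝ) ^ 3 +
            C₂ * ((g.totalDegree : ℝ) * L'.card + M'.card) + ((t : ℝ) * L'.card + s * M'.card))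
    (hL : ∀ ℓ ∈ L, Module.finrank K ℓ.direction = 1)
    (hM : ∀ m ∈ M, Module.finrank K m.direction = 1) (hLM : Disjoint L M)
    (hquad : ∀ G : MvPolynomial (Fin 3) K, G ≠ 0 → G.totalDegree ≤ 2 →
      (L.filter fun ℓ => ∀ z ∈ ℓ, eval z G = 0).card < s ∨
      (M.filter fun m => ∀ z ∈ m, eval z G = 0).card < t)
    (L₀ : Finset (AffineSubspace K (Fin 3 → K))) (hL₀ : L₀ ⊆ L)
    {f : MvPolynomial (Fin 3) K} (hdegD : ∀ g ∈ facs f, g.totalDegree ≤ D)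
    (uv : AffineSubspace K (Fin 3 → K) → (Fin 3 → K) × (Fin 3 → K))
    (hptw : ∀ n ∈ L₀ ∪ M, ∀ g : MvPolynomial (Fin 3) K, lineRes (uv n).1 (uv n).2 g = 0 →
      ∀ z ∈ n, eval z g = 0)
    (asg : AffineSubspace K (Fin 3 → K) → MvPolynomial (Fin 3) K)
    (hasgF : ∀ n, asg n ∈ facs f → lineRes (uv n).1 (uv n).2 (asg n) = 0)
    (ℓ m : (Fin 3 → K) → AffineSubspace K (Fin 3 → K)) {g : MvPolynomial (Fin 3) K}
    (hg : g ∈ facs f) (J : Finset (Fin 3 → K))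
    (hJ : ∀ z ∈ J, (ℓ z ∈ L₀ ∧ z ∈ ℓ z ∧ asg (ℓ z) = g) ∧ (m z ∈ M ∧ z ∈ m z ∧ asg (m z) = g)) :
    (J.card : ℝ) ≤ s * (M.filter fun n => asg n = g).card + t * (L₀.filter fun n => asg n = g).card
      + (C₁ * (g.totalDegree : ℝ) ^ 3 + C₂ * ((g.totalDegree : ℝ) *
        (L₀.filter fun n => asg n = g).card + (M.filter fun n => asg n = g).card)) := by
  obtain ⟨Lg, hLg⟩ : ∃ S, S = L₀.filter fun n => asg n = g := ⟨_, rfl⟩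
  obtain ⟨Mg, hMg⟩ : ∃ S, S = M.filter fun n => asg n = g := ⟨_, rfl⟩
  rw [← hLg, ← hMg]
  have hL₀1 : ∀ ℓ ∈ L₀, Module.finrank K ℓ.direction = 1 := fun ℓ hℓ => hL ℓ (hL₀ hℓ)
  -- lines assigned to `g` lie on `{g = 0}`
  have hLg_on : ∀ n ∈ Lg, ∀ z ∈ n, eval z g = 0 := by
    intro n hn
    rw [hLg] at hn
    obtain ⟨hn0, hng⟩ := mem_filter.1 hn
    have := hasgF n (hng.symm ▸ hg)
    rw [hng] at this
    exact hptw n (mem_union_left _ hn0) g this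
  have hMg_on : ∀ n ∈ Mg, ∀ z ∈ n, eval z g = 0 := by
    intro n hn
    rw [hMg] at hn
    obtain ⟨hn0, hng⟩ := mem_filter.1 hn
    have := hasgF n (hng.symm ▸ hg)
    rw [hng] at this
    exact hptw n (mem_union_right _ hn0) g this
  -- `|J| ≤ |Lg| |Mg|`: a point is determined by its two (distinct) lines
  have hprod : J.card ≤ Lg.card * Mg.card := by
    rw [← card_product]
    refine card_le_card_of_injOn (fun z => (ℓ z, m z)) (fun z hz => ?_) ?_
    · obtain ⟨⟨h1, -, h2⟩, h3, -, h4⟩ := hJ z hz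
      rw [hLg, hMg]
      exact mem_product.2 ⟨mem_filter.2 ⟨h1, h2⟩, mem_filter.2 ⟨h3, h4⟩⟩
    · intro z hz z' hz' h
      simp only [Prod.mk.injEq] at h
      obtain ⟨⟨h1, h2, -⟩, h3, h4, -⟩ := hJ z hz
      obtain ⟨⟨-, h2', -⟩, -, h4', -⟩ := hJ z' hz'
      have hne : ℓ z ≠ m z := fun e => disjoint_left.1 hLM (hL₀ h1) (e ▸ h3)
      exact eq_of_mem_of_mem (hL₀1 _ h1) (hM _ h3) hne h2 h4 (h.1 ▸ h2') (h.2 ▸ h4')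
  have hs0 : (0 : ℝ) ≤ s := Nat.cast_nonneg _
  have ht0 : (0 : ℝ) ≤ t := Nat.cast_nonneg _
  have hLg0 : (0 : ℝ) ≤ Lg.card := Nat.cast_nonneg _
  have hMg0 : (0 : ℝ) ≤ Mg.card := Nat.cast_nonneg _
  have hdg0 : (0 : ℝ) ≤ g.totalDegree := Nat.cast_nonneg _
  have hK0 : 0 ≤ C₁ * (g.totalDegree : ℝ) ^ 3 + C₂ * ((g.totalDegree : ℝ) * Lg.card + Mg.card) :=
    add_nonneg (mul_nonneg hC₁ (pow_nonneg hdg0 3))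
      (mul_nonneg hC₂ (add_nonneg (mul_nonneg hdg0 hLg0) hMg0))
  by_cases hdeg : g.totalDegree ≤ 2
  · -- a plane or a quadric: the hypothesis
    have hq := hquad g (irreducible_of_mem_facs hg).ne_zero hdeg
    have hLg_le : Lg.card ≤ (L.filter fun ℓ => ∀ z ∈ ℓ, eval z g = 0).card :=
      card_le_card fun n hn => mem_filter.2 ⟨hL₀ (by rw [hLg] at hn; exact (mem_filter.1 hn).1),
        hLg_on n hn⟩
    have hMg_le : Mg.card ≤ (M.filter fun m => ∀ z ∈ m, eval z g = 0).card :=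
      card_le_card fun n hn => mem_filter.2 ⟨(by rw [hMg] at hn; exact (mem_filter.1 hn).1),
        hMg_on n hn⟩
    have hcase : Lg.card * Mg.card ≤ s * Mg.card + t * Lg.card := by
      rcases hq with h | h
      · exact (Nat.mul_le_mul_right _ (hLg_le.trans h.le)).trans (Nat.le_add_right _ _)
      · calc Lg.card * Mg.card ≤ Lg.card * t := Nat.mul_le_mul_left _ (hMg_le.trans h.le)
          _ = t * Lg.card := mul_comm _ _
          _ ≤ s * Mg.card + t * Lg.card := Nat.le_add_left _ _
    have h1 : (J.card : ℝ) ≤ s * Mg.card + t * Lg.card := by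
      exact_mod_cast hprod.trans hcase
    linarith
  · -- a component of degree `≥ 3`: the component bound
    push Not at hdeg
    have hLgL : Lg ⊆ L := fun n hn => hL₀ (by rw [hLg] at hn; exact (mem_filter.1 hn).1)
    have hMgM : Mg ⊆ M := fun n hn => by rw [hMg] at hn; exact (mem_filter.1 hn).1
    have hGg := hG g (irreducible_of_mem_facs hg) hdeg (hdegD g hg) Lg Mg hLgL hMgM
      hLg_on hMg_on J
      (fun z hz => by
        obtain ⟨⟨h1, h2, h5⟩, h3, h4, h6⟩ := hJ z hz
        refine ⟨⟨ℓ z, ?_, h2⟩, ⟨m z, ?_, h4⟩⟩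
        · rw [hLg]; exact mem_filter.2 ⟨h1, h5⟩
        · rw [hMg]; exact mem_filter.2 ⟨h3, h6⟩)
    linarith

open scoped Classical in
/-- **de Zeeuw's component count for a given surface** (variant of
`DeZeeuw.card_le_of_componentBound`): if `f ≠ 0`, `deg f ≤ D`, vanishes on every line of
`L₀ ⊆ L` (`K` infinite) and the component bound `hG` holds for the irreducible surfaces of
degree `3 ≤ d ≤ D` and the sub-families of `L, M` on them, then every finite set `I` of points
each lying on a line of `L₀` and a line of `M` has
`|I| ≤ D|M| + D|L₀| + s|M| + t|L₀| + C₁ D³ + C₂ (D|L₀| + |M|)`: intersections of a line with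
components not containing it (Bézout on the line), plane/quadric components (hypothesis
`hquad`), components of degree `≥ 3` (`hG`); lines are assigned to the component of least index
containing them. [cite: deZeeuw2016, Lemma 3.1 (proof, §3)] -/
theorem card_le_of_componentBound' [Infinite K] {C₁ C₂ : ℝ} (hC₁ : 0 ≤ C₁) (hC₂ : 0 ≤ C₂)
    (L M : Finset (AffineSubspace K (Fin 3 → K))) (s t D : ℕ)
    (hG : ∀ g : MvPolynomial (Fin 3) K, Irreducible g → 3 ≤ g.totalDegree →
      g.totalDegree ≤ D →
      ∀ (L' M' : Finset (AffineSubspace K (Fin 3 → K))), L' ⊆ L → M' ⊆ M →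
        (∀ ℓ ∈ L', ∀ z ∈ ℓ, eval z g = 0) → (∀ m ∈ M', ∀ z ∈ m, eval z g = 0) →
        ∀ I : Finset (Fin 3 → K), (∀ z ∈ I, (∃ ℓ ∈ L', z ∈ ℓ) ∧ (∃ m ∈ M', z ∈ m)) →
          (I.card : ℝ) ≤ C₁ * (g.totalDegree : ℝ) ^ 3 +
            C₂ * ((g.totalDegree : ℝ) * L'.card + M'.card) + ((t : ℝ) * L'.card + s * M'.card))
    (hL : ∀ ℓ ∈ L, Module.finrank K ℓ.direction = 1)
    (hM : ∀ m ∈ M, Module.finrank K m.direction = 1) (hLM : Disjoint L M)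
    (hquad : ∀ G : MvPolynomial (Fin 3) K, G ≠ 0 → G.totalDegree ≤ 2 →
      (L.filter fun ℓ => ∀ z ∈ ℓ, eval z G = 0).card < s ∨
      (M.filter fun m => ∀ z ∈ m, eval z G = 0).card < t)
    (L₀ : Finset (AffineSubspace K (Fin 3 → K))) (hL₀ : L₀ ⊆ L)
    {f : MvPolynomial (Fin 3) K} (hf0 : f ≠ 0) (hfD : f.totalDegree ≤ D)
    (hfL : ∀ ℓ ∈ L₀, ∀ z ∈ ℓ, eval z f = 0)
    (I : Finset (Fin 3 → K)) (hI : ∀ z ∈ I, (∃ ℓ ∈ L₀, z ∈ ℓ) ∧ (∃ m ∈ M, z ∈ m)) :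
    (I.card : ℝ) ≤ (D : ℝ) * M.card + D * L₀.card + s * M.card + t * L₀.card +
      (C₁ * (D : ℝ) ^ 3 + C₂ * ((D : ℝ) * L₀.card + M.card)) := by
  have hL₀1 : ∀ ℓ ∈ L₀, Module.finrank K ℓ.direction = 1 := fun ℓ hℓ => hL ℓ (hL₀ hℓ)
  -- parametrizations of all lines of `L₀ ∪ M`
  have hpar : ∀ n ∈ L₀ ∪ M, ∃ uv : (Fin 3 → K) × (Fin 3 → K), uv.2 ≠ 0 ∧
      ∀ z, z ∈ n ↔ ∃ t : K, z = uv.1 + t • uv.2 := by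
    intro n hn
    rcases mem_union.1 hn with h | h
    · exact exists_param n (hL₀1 n h)
    · exact exists_param n (hM n h)
  choose! uv huv0 huv using hpar
  have hptw : ∀ n ∈ L₀ ∪ M, ∀ g : MvPolynomial (Fin 3) K, lineRes (uv n).1 (uv n).2 g = 0 →
      ∀ z ∈ n, eval z g = 0 := by
    intro n hn g hg z hz
    obtain ⟨t, rfl⟩ := (huv n hn z).1 hz
    exact eval_of_lineRes_eq_zero hg t
  -- `f` vanishes formally on the lines of `L₀`
  have hfL' : ∀ ℓ ∈ L₀, lineRes (uv ℓ).1 (uv ℓ).2 f = 0 := by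
    intro ℓ hℓ
    unfold lineRes
    exact Literature.Combinatorics.Extremal.aeval_line_eq_zero_of_forall_eval _ _
      (fun t => hfL ℓ hℓ _ ((huv ℓ (mem_union_left _ hℓ) _).2 ⟨t, rfl⟩))
  have hsumdeg : ∑ g ∈ facs f, g.totalDegree ≤ D := (sum_totalDegree_facs_le hf0).trans hfD
  have hdegD : ∀ g ∈ facs f, g.totalDegree ≤ D := fun g hg =>
    (totalDegree_le_of_mem_facs hf0 hg).trans hfD
  -- assignment of a line to the factor of least rank vanishing formally on it
  have hasg : ∀ n : AffineSubspace K (Fin 3 → K), ∃ g : MvPolynomial (Fin 3) K,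
      (((facs f).filter fun g => lineRes (uv n).1 (uv n).2 g = 0).Nonempty →
        (g ∈ (facs f).filter fun g => lineRes (uv n).1 (uv n).2 g = 0) ∧
        ∀ g' ∈ (facs f).filter fun g => lineRes (uv n).1 (uv n).2 g = 0, rk f g ≤ rk f g') ∧
      (¬ ((facs f).filter fun g => lineRes (uv n).1 (uv n).2 g = 0).Nonempty → g = 0) := by
    intro n
    by_cases h : ((facs f).filter fun g => lineRes (uv n).1 (uv n).2 g = 0).Nonempty
    · obtain ⟨g, hg, hmin⟩ := exists_min_image _ (rk f) h
      exact ⟨g, fun _ => ⟨hg, hmin⟩, fun h' => absurd h h'⟩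
    · exact ⟨0, fun h' => absurd h' h, fun _ => rfl⟩
  choose asg hasg1 hasg2 using hasg
  have hasgF : ∀ n, asg n ∈ facs f → lineRes (uv n).1 (uv n).2 (asg n) = 0 ∧
      ∀ g' ∈ facs f, lineRes (uv n).1 (uv n).2 g' = 0 → rk f (asg n) ≤ rk f g' := by
    intro n hn
    have hne : ((facs f).filter fun g => lineRes (uv n).1 (uv n).2 g = 0).Nonempty := by
      by_contra h
      exact zero_notMem_facs f (hasg2 n h ▸ hn)
    obtain ⟨hmem, hmin⟩ := hasg1 n hne
    exact ⟨(mem_filter.1 hmem).2, fun g' hg' hg'0 => hmin g' (mem_filter.2 ⟨hg', hg'0⟩)⟩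
  have hasg_of : ∀ n, ∀ g ∈ facs f, lineRes (uv n).1 (uv n).2 g = 0 →
      asg n ∈ facs f ∧ rk f (asg n) ≤ rk f g := by
    intro n g hg hg0
    have hne : ((facs f).filter fun g => lineRes (uv n).1 (uv n).2 g = 0).Nonempty :=
      ⟨g, mem_filter.2 ⟨hg, hg0⟩⟩
    obtain ⟨hmem, hmin⟩ := hasg1 n hne
    exact ⟨(mem_filter.1 hmem).1, hmin g (mem_filter.2 ⟨hg, hg0⟩)⟩
  have hasgL : ∀ ℓ ∈ L₀, asg ℓ ∈ facs f := by
    intro ℓ hℓ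
    obtain ⟨g, hg, hg0⟩ := exists_mem_facs_lineRes_eq_zero hf0 (hfL' ℓ hℓ)
    exact (hasg_of ℓ g hg hg0).1
  -- the two lines through each point of `I`
  choose! ℓ hℓ hzℓ using fun z (hz : z ∈ I) => (hI z hz).1
  choose! m hm hzm using fun z (hz : z ∈ I) => (hI z hz).2
  -- the three kinds of points
  obtain ⟨IA, hIA⟩ : ∃ S, S = I.filter fun z => ∃ g ∈ facs f, eval z g = 0 ∧
    lineRes (uv (m z)).1 (uv (m z)).2 g ≠ 0 := ⟨_, rfl⟩
  obtain ⟨IA', hIA'⟩ : ∃ S, S = I.filter fun z => ∃ g ∈ facs f, eval z g = 0 ∧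
    lineRes (uv (ℓ z)).1 (uv (ℓ z)).2 g ≠ 0 := ⟨_, rfl⟩
  obtain ⟨IB, hIB⟩ : ∃ S, S = I.filter fun z => asg (m z) = asg (ℓ z) := ⟨_, rfl⟩
  have hcover : I ⊆ IA ∪ IA' ∪ IB := by
    intro z hz
    have hg₁ : asg (ℓ z) ∈ facs f := hasgL _ (hℓ z hz)
    have hz1 : eval z (asg (ℓ z)) = 0 :=
      hptw _ (mem_union_left _ (hℓ z hz)) _ (hasgF _ hg₁).1 z (hzℓ z hz)
    by_cases h1 : lineRes (uv (m z)).1 (uv (m z)).2 (asg (ℓ z)) = 0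
    · obtain ⟨hg₂, hrk⟩ := hasg_of (m z) _ hg₁ h1
      by_cases h2 : asg (m z) = asg (ℓ z)
      · rw [hIB]
        exact mem_union_right _ (mem_filter.2 ⟨hz, h2⟩)
      · have hlt : rk f (asg (m z)) < rk f (asg (ℓ z)) :=
          lt_of_le_of_ne hrk fun h => h2 (rk_injOn f hg₂ hg₁ h)
        have hz2 : eval z (asg (m z)) = 0 :=
          hptw _ (mem_union_right _ (hm z hz)) _ (hasgF _ hg₂).1 z (hzm z hz)
        by_cases h3 : lineRes (uv (ℓ z)).1 (uv (ℓ z)).2 (asg (m z)) = 0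
        · exact absurd ((hasgF _ hg₁).2 _ hg₂ h3) (not_le.2 hlt)
        · rw [hIA']
          exact mem_union_left _ (mem_union_right _
            (mem_filter.2 ⟨hz, asg (m z), hg₂, hz2, h3⟩))
    · rw [hIA]
      exact mem_union_left _ (mem_union_left _ (mem_filter.2 ⟨hz, asg (ℓ z), hg₁, hz1, h1⟩))
  -- (A), (A'): Bézout on lines
  have hA : IA.card ≤ M.card * D := by
    rw [hIA]
    exact (card_filter_offComponent_le hf0 M uv (fun n hn => huv n (mem_union_right _ hn)) I m
      (fun z hz => ⟨hm z hz, hzm z hz⟩)).trans (Nat.mul_le_mul_left _ hfD)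
  have hA' : IA'.card ≤ L₀.card * D := by
    rw [hIA']
    exact (card_filter_offComponent_le hf0 L₀ uv (fun n hn => huv n (mem_union_left _ hn)) I ℓ
      (fun z hz => ⟨hℓ z hz, hzℓ z hz⟩)).trans (Nat.mul_le_mul_left _ hfD)
  -- (B): same component, fibrewise over the factors
  have hBfib : IB.card = ∑ g ∈ facs f, (IB.filter fun z => asg (ℓ z) = g).card :=
    card_eq_sum_card_fiberwise fun z hz => hasgL _ (hℓ z (by rw [hIB] at hz; exact (mem_filter.1 hz).1))
  have hBg : ∀ g ∈ facs f, ((IB.filter fun z => asg (ℓ z) = g).card : ℝ) ≤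
      s * (M.filter fun n => asg n = g).card + t * (L₀.filter fun n => asg n = g).card +
      (C₁ * (g.totalDegree : ℝ) ^ 3 + C₂ * ((g.totalDegree : ℝ) *
        (L₀.filter fun n => asg n = g).card + (M.filter fun n => asg n = g).card)) := by
    intro g hg
    refine card_sameComponent_le' hC₁ hC₂ L M s t D hG hL hM hLM hquad L₀ hL₀ hdegD uv hptw
      asg (fun n hn => (hasgF n hn).1) ℓ m hg _ fun z hz => ?_
    obtain ⟨hz1, hz2⟩ := mem_filter.1 hz
    rw [hIB] at hz1
    obtain ⟨hzI, hz3⟩ := mem_filter.1 hz1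
    exact ⟨⟨hℓ z hzI, hzℓ z hzI, hz2⟩, hm z hzI, hzm z hzI, hz3.trans hz2⟩
  have hB : (IB.card : ℝ) ≤ s * M.card + t * L₀.card +
      (C₁ * (D : ℝ) ^ 3 + C₂ * ((D : ℝ) * L₀.card + M.card)) := by
    rw [hBfib]
    push_cast
    refine (sum_le_sum hBg).trans ?_
    have e1 : (∑ g ∈ facs f, ((M.filter fun n => asg n = g).card : ℝ)) ≤ M.card := by
      exact_mod_cast sum_card_filter_eq_le M (facs f) asg
    have e2 : (∑ g ∈ facs f, ((L₀.filter fun n => asg n = g).card : ℝ)) ≤ L₀.card := by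
      exact_mod_cast sum_card_filter_eq_le L₀ (facs f) asg
    have e3 : (∑ g ∈ facs f, (g.totalDegree : ℝ) ^ 3) ≤ (D : ℝ) ^ 3 := by
      exact_mod_cast sum_pow_three_le (facs f) (fun g => g.totalDegree) hsumdeg
    have e4 : (∑ g ∈ facs f, (g.totalDegree : ℝ) * (L₀.filter fun n => asg n = g).card) ≤
        D * L₀.card := by
      calc (∑ g ∈ facs f, (g.totalDegree : ℝ) * (L₀.filter fun n => asg n = g).card)
          ≤ ∑ g ∈ facs f, (D : ℝ) * (L₀.filter fun n => asg n = g).card :=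
            sum_le_sum fun g hg => mul_le_mul_of_nonneg_right
              (by exact_mod_cast hdegD g hg) (Nat.cast_nonneg _)
        _ = D * ∑ g ∈ facs f, ((L₀.filter fun n => asg n = g).card : ℝ) := by
            rw [mul_sum]
        _ ≤ D * L₀.card := mul_le_mul_of_nonneg_left e2 (Nat.cast_nonneg _)
    have hs0 : (0 : ℝ) ≤ s := Nat.cast_nonneg _
    have ht0 : (0 : ℝ) ≤ t := Nat.cast_nonneg _
    have hsum_eq : ∑ g ∈ facs f, ((s : ℝ) * (M.filter fun n => asg n = g).card +
          t * (L₀.filter fun n => asg n = g).card +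
          (C₁ * (g.totalDegree : ℝ) ^ 3 + C₂ * ((g.totalDegree : ℝ) *
            (L₀.filter fun n => asg n = g).card + (M.filter fun n => asg n = g).card)))
        = s * ∑ g ∈ facs f, ((M.filter fun n => asg n = g).card : ℝ) +
          t * ∑ g ∈ facs f, ((L₀.filter fun n => asg n = g).card : ℝ) +
          (C₁ * ∑ g ∈ facs f, (g.totalDegree : ℝ) ^ 3 +
            C₂ * (∑ g ∈ facs f, (g.totalDegree : ℝ) * (L₀.filter fun n => asg n = g).card +
              ∑ g ∈ facs f, ((M.filter fun n => asg n = g).card : ℝ))) := by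
      simp only [sum_add_distrib, ← mul_sum]
    rw [hsum_eq]
    exact add_le_add (add_le_add (mul_le_mul_of_nonneg_left e1 hs0)
      (mul_le_mul_of_nonneg_left e2 ht0))
      (add_le_add (mul_le_mul_of_nonneg_left e3 hC₁)
        (mul_le_mul_of_nonneg_left (add_le_add e4 e1) hC₂))
  -- conclusion
  have hIcard : I.card ≤ IA.card + IA'.card + IB.card :=
    (card_le_card hcover).trans ((card_union_le _ _).trans
      (Nat.add_le_add_right (card_union_le _ _) _))
  have h1 : (I.card : ℝ) ≤ IA.card + IA'.card + IB.card := by exact_mod_cast hIcard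
  have h2 : (IA.card : ℝ) ≤ M.card * D := by exact_mod_cast hA
  have h3 : (IA'.card : ℝ) ≤ L₀.card * D := by exact_mod_cast hA'
  linarith

end ComponentCount


/-! ### The component bound from the induction hypothesis and the ruled-surface structure -/

section OneComponent

variable {K : Type} [Field K] [IsAlgClosed K]

/-- `√x · y ≤ 244 d³` when `x + y ≤ 39 d²` (`39^{3/2} < 244`). [folklore] -/
theorem sqrt_mul_le_of_add_le {x y d : ℝ} (hx : 0 ≤ x) (hy : 0 ≤ y) (hd : 0 ≤ d)
    (h : x + y ≤ 39 * d ^ 2) : Real.sqrt x * y ≤ 244 * d ^ 3 := by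
  have h1 : Real.sqrt x ≤ Real.sqrt (x + y) := Real.sqrt_le_sqrt (by linarith)
  have h2 : Real.sqrt (x + y) ≤ (25 / 4) * d := by
    rw [Real.sqrt_le_left (by positivity)]
    nlinarith
  have h3 : Real.sqrt x ≤ (25 / 4) * d := h1.trans h2
  have h4 : y ≤ 39 * d ^ 2 := by linarith
  calc Real.sqrt x * y ≤ ((25 / 4) * d) * (39 * d ^ 2) :=
        mul_le_mul h3 h4 hy (by positivity)
    _ = (975 / 4) * d ^ 3 := by ring
    _ ≤ 244 * d ^ 3 := by nlinarith [pow_nonneg hd 3]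

open scoped Classical in
/-- **The component bound for one irreducible factor of the reduced-degree surface.** In the
inductive step for the families `L, M` (sizes `a ≤ b`), let `g` be irreducible of degree
`3 ≤ d ≤ D` with `char K = 0` or `D < char K` and `39 D² < a + b`, and let `L' ⊆ L`, `M' ⊆ M`
lie on `{g = 0}`. Then the points on a line of `L'` and a line of `M'` number at most
`244 C d³ + 3 (d|L'| + |M'|) + (t|L'| + s|M'|)`:
* `{g = 0}` not generically ruled: it carries at most `39 d² < a + b` lines
  (`card_lines_le_of_not_generically_ruled`), so the induction hypothesis `IH` (for the smaller
  of `L', M'` first) gives `C √(min) · max + (t|L'| + s|M'|)`, and `√(min) · max ≤ 244 d³`;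
* a cone: at most one point (`card_le_one_of_cone`); a cylinder: none
  (`card_eq_zero_of_cylinder`);
* any other ruled surface: `≤ (d + 1)|L'| + 2|M'|` by `crossing_bound_of_generically_ruled`
  (a non-special line of `L'` carries `≤ d - 1` points on non-special lines of `M'` and `≤ 2`
  on the special ones; a special line of `L'` carries `≤ |M'|`).
[cite: GuthKatz2015, §3 (proof of the `P₂` bound: "optimality of the example" for the unruled
factor, Lemma 3.4 for the ruled factor)] [cite: Kollar2015, §2 (20), Corollary 21] -/
theorem componentBound_of_induction {c₀ C : ℝ} (hC : 0 ≤ C)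
    (L M : Finset (AffineSubspace K (Fin 3 → K))) (s t D : ℕ)
    (hL : ∀ ℓ ∈ L, Module.finrank K ℓ.direction = 1)
    (hM : ∀ m ∈ M, Module.finrank K m.direction = 1) (hLM : Disjoint L M)
    (hchar : ringChar K = 0 ∨ (L.card : ℝ) ≤ c₀ * (ringChar K : ℝ) ^ 2)
    (hquad : ∀ G : MvPolynomial (Fin 3) K, G ≠ 0 → G.totalDegree ≤ 2 →
      (L.filter fun ℓ => ∀ z ∈ ℓ, eval z G = 0).card < s ∨
      (M.filter fun m => ∀ z ∈ m, eval z G = 0).card < t)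
    (hDp : ringChar K = 0 ∨ D < ringChar K)
    (hD39 : (39 : ℝ) * (D : ℝ) ^ 2 < (L.card : ℝ) + M.card)
    (IH : ∀ (L' M' : Finset (AffineSubspace K (Fin 3 → K))) (s' t' : ℕ),
      (∀ ℓ ∈ L', Module.finrank K ℓ.direction = 1) →
      (∀ m ∈ M', Module.finrank K m.direction = 1) → Disjoint L' M' →
      L'.card ≤ M'.card → L'.card + M'.card < L.card + M.card →
      (ringChar K = 0 ∨ (L'.card : ℝ) ≤ c₀ * (ringChar K : ℝ) ^ 2) →
      (∀ G : MvPolynomial (Fin 3) K, G ≠ 0 → G.totalDegree ≤ 2 →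
        (L'.filter fun ℓ => ∀ z ∈ ℓ, eval z G = 0).card < s' ∨
        (M'.filter fun m => ∀ z ∈ m, eval z G = 0).card < t') →
      ∀ I : Finset (Fin 3 → K), (∀ z ∈ I, (∃ ℓ ∈ L', z ∈ ℓ) ∧ (∃ m ∈ M', z ∈ m)) →
        (I.card : ℝ) ≤ C * Real.sqrt L'.card * M'.card + ((t' : ℝ) * L'.card + s' * M'.card)) :
    ∀ g : MvPolynomial (Fin 3) K, Irreducible g → 3 ≤ g.totalDegree → g.totalDegree ≤ D →
      ∀ (L' M' : Finset (AffineSubspace K (Fin 3 → K))), L' ⊆ L → M' ⊆ M →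
        (∀ ℓ ∈ L', ∀ z ∈ ℓ, eval z g = 0) → (∀ m ∈ M', ∀ z ∈ m, eval z g = 0) →
        ∀ I : Finset (Fin 3 → K), (∀ z ∈ I, (∃ ℓ ∈ L', z ∈ ℓ) ∧ (∃ m ∈ M', z ∈ m)) →
          (I.card : ℝ) ≤ (244 * C) * (g.totalDegree : ℝ) ^ 3 +
            3 * ((g.totalDegree : ℝ) * L'.card + M'.card) + ((t : ℝ) * L'.card + s * M'.card) := by
  classical
  intro g hg hd3 hdD L' M' hL'L hM'M hL'g hM'g I hI
  haveI : Infinite K := IsAlgClosed.instInfinite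
  have hL'1 : ∀ ℓ ∈ L', Module.finrank K ℓ.direction = 1 := fun ℓ hℓ => hL ℓ (hL'L hℓ)
  have hM'1 : ∀ m ∈ M', Module.finrank K m.direction = 1 := fun m hm => hM m (hM'M hm)
  have hL'M' : Disjoint L' M' := hLM.mono hL'L hM'M
  have hd0 : (0 : ℝ) ≤ g.totalDegree := Nat.cast_nonneg _
  have hd1 : (1 : ℝ) ≤ g.totalDegree := by exact_mod_cast (show 1 ≤ g.totalDegree by omega)
  have hL0 : (0 : ℝ) ≤ L'.card := Nat.cast_nonneg _
  have hM0 : (0 : ℝ) ≤ M'.card := Nat.cast_nonneg _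
  have hs0 : (0 : ℝ) ≤ s := Nat.cast_nonneg _
  have ht0 : (0 : ℝ) ≤ t := Nat.cast_nonneg _
  have hRHS0 : 0 ≤ (244 * C) * (g.totalDegree : ℝ) ^ 3 +
      3 * ((g.totalDegree : ℝ) * L'.card + M'.card) + ((t : ℝ) * L'.card + s * M'.card) := by
    positivity
  by_cases hruled : ∃ h : MvPolynomial (Fin 3) K, ¬ g ∣ h ∧ ∀ p : Fin 3 → K, eval p g = 0 →
      eval p h ≠ 0 → ∃ ℓ : AffineSubspace K (Fin 3 → K),
        Module.finrank K ℓ.direction = 1 ∧ p ∈ ℓ ∧ ∀ q ∈ ℓ, eval q g = 0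
  · /- RULED -/
    by_cases hcone : ∃ p : Fin 3 → K, (translate p g).IsHomogeneous g.totalDegree
    · obtain ⟨p, hp⟩ := hcone
      have h1 : I.card ≤ 1 := Literature.Combinatorics.Extremal.card_le_one_of_cone hg p hp
        (by omega) L' M' hL'1 hM'1 hL'M' hL'g hM'g I hI
      rcases I.eq_empty_or_nonempty with hIe | ⟨z, hz⟩
      · rw [hIe, card_empty, Nat.cast_zero]
        exact hRHS0
      · obtain ⟨-, m, hm, -⟩ := hI z hz
        have hM1 : (1 : ℝ) ≤ M'.card := by exact_mod_cast card_pos.2 ⟨m, hm⟩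
        have h1' : (I.card : ℝ) ≤ 1 := by exact_mod_cast h1
        nlinarith [mul_nonneg hd0 hL0, mul_nonneg hC (pow_nonneg hd0 3), mul_nonneg ht0 hL0,
          mul_nonneg hs0 hM0]
    by_cases hcyl : ∃ v : Fin 3 → K, v ≠ 0 ∧ ∀ (p : Fin 3 → K) (t : K),
        eval (p + t • v) g = eval p g
    · obtain ⟨v, hv, hcv⟩ := hcyl
      have h0 : I.card = 0 := Literature.Combinatorics.Extremal.card_eq_zero_of_cylinder hg
        (by omega) hv hcv L' M' hL'1 hM'1 hL'M' hL'g hM'g I hI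
      rw [h0, Nat.cast_zero]
      exact hRHS0
    obtain ⟨E, hE2, hE⟩ :=
      Literature.Combinatorics.Extremal.crossing_bound_of_generically_ruled hg hd3 hruled hcone hcyl
    -- choose, for every point of `I`, a line of `M'` through it
    have hMch : ∀ z ∈ I, ∃ m ∈ M', z ∈ m := fun z hz => (hI z hz).2
    choose! mOf hmOfM hzmOf using hMch
    have hinj : ∀ ℓ ∈ L', Set.InjOn mOf ↑(I.filter fun z => z ∈ ℓ) := by
      intro ℓ hℓ z hz z' hz' heq
      rw [coe_filter] at hz hz'
      obtain ⟨hzI, hzℓ⟩ := hz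
      obtain ⟨hz'I, hz'ℓ⟩ := hz'
      have hne : ℓ ≠ mOf z := fun h => disjoint_left.1 hL'M' hℓ (h ▸ hmOfM z hzI)
      have hz'm : z' ∈ mOf z := by rw [heq]; exact hzmOf z' hz'I
      exact eq_of_mem_of_mem (hL'1 ℓ hℓ) (hM'1 _ (hmOfM z hzI)) hne hzℓ (hzmOf z hzI) hz'ℓ hz'm
    have hcount : ∀ ℓ ∈ L', ∀ T : Finset (AffineSubspace K (Fin 3 → K)),
        ((I.filter fun z => z ∈ ℓ).filter fun z => mOf z ∈ T).card ≤ T.card := by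
      intro ℓ hℓ T
      have hinj' : Set.InjOn mOf ↑((I.filter fun z => z ∈ ℓ).filter fun z => mOf z ∈ T) :=
        (hinj ℓ hℓ).mono (by
          intro z hz
          exact mem_coe.2 (mem_filter.1 (mem_coe.1 hz)).1)
      calc ((I.filter fun z => z ∈ ℓ).filter fun z => mOf z ∈ T).card
          = (((I.filter fun z => z ∈ ℓ).filter fun z => mOf z ∈ T).image mOf).card :=
            (card_image_of_injOn hinj').symm
        _ ≤ T.card := card_le_card (by
            intro m hm
            rw [mem_image] at hm
            obtain ⟨z, hz, rfl⟩ := hm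
            exact (mem_filter.1 hz).2)
    have hline : ∀ ℓ ∈ L',
        (I.filter fun z => z ∈ ℓ).card ≤ if ℓ ∈ E then M'.card else g.totalDegree + 1 := by
      intro ℓ hℓ
      split_ifs with hℓE
      · calc (I.filter fun z => z ∈ ℓ).card
            = ((I.filter fun z => z ∈ ℓ).filter fun z => mOf z ∈ M').card := by
              congr 1
              refine (filter_true_of_mem ?_).symm
              intro z hz
              exact hmOfM z (mem_filter.1 hz).1
          _ ≤ M'.card := hcount ℓ hℓ M'
      · have hA : ((I.filter fun z => z ∈ ℓ).filter fun z => mOf z ∉ E).card + 1 ≤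
            g.totalDegree := by
          refine hE ℓ (hL'1 ℓ hℓ) (hL'g ℓ hℓ) hℓE _ ?_
          intro z hz
          rw [mem_filter, mem_filter] at hz
          obtain ⟨⟨hzI, hzℓ⟩, hmE⟩ := hz
          refine ⟨hzℓ, mOf z, hM'1 _ (hmOfM z hzI), hM'g _ (hmOfM z hzI), ?_, hmE, hzmOf z hzI⟩
          exact fun h => disjoint_left.1 hL'M' hℓ (h ▸ hmOfM z hzI)
        have hB : ((I.filter fun z => z ∈ ℓ).filter fun z => mOf z ∈ E).card ≤ 2 :=
          (hcount ℓ hℓ E).trans hE2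
        have hsplit : (I.filter fun z => z ∈ ℓ).card ≤
            ((I.filter fun z => z ∈ ℓ).filter fun z => mOf z ∉ E).card +
              ((I.filter fun z => z ∈ ℓ).filter fun z => mOf z ∈ E).card :=
          calc (I.filter fun z => z ∈ ℓ).card
              ≤ (((I.filter fun z => z ∈ ℓ).filter fun z => mOf z ∉ E) ∪
                  ((I.filter fun z => z ∈ ℓ).filter fun z => mOf z ∈ E)).card :=
                card_le_card (by
                  intro z hz
                  by_cases h : mOf z ∈ E
                  · exact mem_union_right _ (mem_filter.2 ⟨hz, h⟩)
                  · exact mem_union_left _ (mem_filter.2 ⟨hz, h⟩))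
            _ ≤ _ := card_union_le _ _
        omega
    have hcover : I ⊆ L'.biUnion fun ℓ => I.filter fun z => z ∈ ℓ := by
      intro z hz
      obtain ⟨⟨ℓ, hℓ, hzℓ⟩, -⟩ := hI z hz
      exact mem_biUnion.2 ⟨ℓ, hℓ, mem_filter.2 ⟨hz, hzℓ⟩⟩
    have hLE : (L'.filter fun ℓ => ℓ ∈ E).card ≤ 2 :=
      (card_le_card fun ℓ hℓ => (mem_filter.1 hℓ).2).trans hE2
    have hnat : I.card ≤ (g.totalDegree + 1) * L'.card + 2 * M'.card :=
      calc I.card ≤ (L'.biUnion fun ℓ => I.filter fun z => z ∈ ℓ).card := card_le_card hcover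
        _ ≤ ∑ ℓ ∈ L', (I.filter fun z => z ∈ ℓ).card := card_biUnion_le
        _ ≤ ∑ ℓ ∈ L', (if ℓ ∈ E then M'.card else g.totalDegree + 1) := sum_le_sum hline
        _ = ∑ ℓ ∈ L'.filter (fun ℓ => ℓ ∈ E), M'.card +
              ∑ ℓ ∈ L'.filter (fun ℓ => ¬ ℓ ∈ E), (g.totalDegree + 1) := sum_ite _ _
        _ = (L'.filter fun ℓ => ℓ ∈ E).card * M'.card +
              (L'.filter fun ℓ => ¬ ℓ ∈ E).card * (g.totalDegree + 1) := by
            rw [sum_const, sum_const, smul_eq_mul, smul_eq_mul]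
        _ ≤ 2 * M'.card + L'.card * (g.totalDegree + 1) := by
            gcongr
            exact filter_subset _ _
        _ = (g.totalDegree + 1) * L'.card + 2 * M'.card := by ring
    have hreal : (I.card : ℝ) ≤ (g.totalDegree + 1) * L'.card + 2 * M'.card := by
      exact_mod_cast hnat
    nlinarith [mul_nonneg hd0 hL0, mul_nonneg hC (pow_nonneg hd0 3)]
  · /- NON-RULED: few lines, induction hypothesis -/
    have hcharg : ringChar K = 0 ∨ g.totalDegree < ringChar K :=
      hDp.imp id fun h => lt_of_le_of_lt hdD h
    have hΛ1 : ∀ ℓ ∈ L' ∪ M', Module.finrank K ℓ.direction = 1 := by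
      intro ℓ hℓ
      rcases mem_union.1 hℓ with h | h
      exacts [hL'1 ℓ h, hM'1 ℓ h]
    have hΛg : ∀ ℓ ∈ L' ∪ M', ∀ z ∈ ℓ, eval z g = 0 := by
      intro ℓ hℓ
      rcases mem_union.1 hℓ with h | h
      exacts [hL'g ℓ h, hM'g ℓ h]
    have hΛ := Literature.Combinatorics.Extremal.card_lines_le_of_not_generically_ruled hg hd3
      hcharg hruled (L' ∪ M') hΛ1 hΛg
    rw [card_union_of_disjoint hL'M'] at hΛ
    have hsumR : (L'.card : ℝ) + M'.card ≤ 39 * (g.totalDegree : ℝ) ^ 2 := by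
      have : ((L'.card + M'.card : ℕ) : ℝ) ≤ ((g.totalDegree * (39 * g.totalDegree) : ℕ) : ℝ) := by
        exact_mod_cast hΛ
      push_cast at this
      linarith
    have hdDR : (g.totalDegree : ℝ) ≤ D := by exact_mod_cast hdD
    have hlt : L'.card + M'.card < L.card + M.card := by
      have h1 : (L'.card : ℝ) + M'.card < L.card + M.card :=
        calc (L'.card : ℝ) + M'.card ≤ 39 * (g.totalDegree : ℝ) ^ 2 := hsumR
          _ ≤ 39 * (D : ℝ) ^ 2 := by gcongr
          _ < L.card + M.card := hD39
      exact_mod_cast h1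
    -- the hypothesis on planes and quadrics passes to sub-families
    have hquad' : ∀ G : MvPolynomial (Fin 3) K, G ≠ 0 → G.totalDegree ≤ 2 →
        (L'.filter fun ℓ => ∀ z ∈ ℓ, eval z G = 0).card < s ∨
        (M'.filter fun m => ∀ z ∈ m, eval z G = 0).card < t := by
      intro G hG0 hG2
      rcases hquad G hG0 hG2 with h | h
      · exact Or.inl (lt_of_le_of_lt (card_le_card (filter_subset_filter _ hL'L)) h)
      · exact Or.inr (lt_of_le_of_lt (card_le_card (filter_subset_filter _ hM'M)) h)
    have hL'L_card : (L'.card : ℝ) ≤ L.card := by exact_mod_cast card_le_card hL'L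
    by_cases hxy : L'.card ≤ M'.card
    · have hch' : ringChar K = 0 ∨ (L'.card : ℝ) ≤ c₀ * (ringChar K : ℝ) ^ 2 :=
        hchar.imp id fun h => hL'L_card.trans h
      have h := IH L' M' s t hL'1 hM'1 hL'M' hxy hlt hch' hquad' I hI
      have hb := sqrt_mul_le_of_add_le hL0 hM0 hd0 hsumR
      nlinarith [mul_nonneg hd0 hL0]
    · push Not at hxy
      have hM'L' : (M'.card : ℝ) ≤ L'.card := by exact_mod_cast hxy.le
      have hch' : ringChar K = 0 ∨ (M'.card : ℝ) ≤ c₀ * (ringChar K : ℝ) ^ 2 :=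
        hchar.imp id fun h => hM'L'.trans (hL'L_card.trans h)
      have hquad'' : ∀ G : MvPolynomial (Fin 3) K, G ≠ 0 → G.totalDegree ≤ 2 →
          (M'.filter fun ℓ => ∀ z ∈ ℓ, eval z G = 0).card < t ∨
          (L'.filter fun m => ∀ z ∈ m, eval z G = 0).card < s :=
        fun G hG0 hG2 => (hquad' G hG0 hG2).symm
      have h := IH M' L' t s hM'1 hL'1 hL'M'.symm hxy.le (by omega) hch' hquad'' I
        (fun z hz => (hI z hz).symm)
      have hb := sqrt_mul_le_of_add_le hM0 hL0 hd0 (by linarith)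
      nlinarith [mul_nonneg hd0 hL0]

end OneComponent


/-! ### The inductive step: pruning, sampling, degree reduction, component count -/

section Step

variable {K : Type} [Field K] [IsAlgClosed K]

open scoped Classical in
/-- **The inductive step of the Guth–Katz induction (bipartite form).** Families `L, M` of
sizes `a ≤ b`; assume the bound `C √a' b' + (t'a' + s'b')` for all sub-configurations with
fewer lines (`IH`). If `a ≤ C²` the trivial bound `|I| ≤ ab ≤ C √a b` suffices. Otherwise:
lines of `L` carrying fewer than `A₁ = C b/(10√a)` points of `I` contribute `≤ C √a b / 10`;
for a `k`-subset `T ⊆ M`, `k = ⌈9600 a/C²⌉`, chosen by `exists_subset_few_small` for the targets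
"`M`-lines through the points of `I` on `ℓ`" (`ℓ ∈ L` rich), all but `≤ C √a/240` rich lines
meet more than `D = ⌊√(6k)⌋ ≤ 243 √a/C` lines of `T` at distinct points, hence lie on the surface
`{p = 0}` of degree `≤ D` through `T` (`exists_surface_through_lines`, Bézout on the line); the
failed rich lines contribute `≤ C √a b/240`; the points on the good lines are counted by
`card_le_of_componentBound'` with the component bound `componentBound_of_induction`
(`39 D² < a`, and `D < p` in characteristic `p` since `a ≤ c₀ p²` and `C ≥ 250 √c₀`).
[cite: GuthKatz2015, §3 (degree reduction: "we select a random subset … Thus ends the degree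
reduction argument")] [cite: deZeeuw2016, Lemma 3.1 (proof, §3)] -/
theorem lineIntersection_step {c₀ C : ℝ} (hc₀ : 0 < c₀) (hC5 : (100000 : ℝ) ≤ C)
    (hCc : 250 * Real.sqrt c₀ ≤ C)
    (L M : Finset (AffineSubspace K (Fin 3 → K))) (s t : ℕ)
    (hL : ∀ ℓ ∈ L, Module.finrank K ℓ.direction = 1)
    (hM : ∀ m ∈ M, Module.finrank K m.direction = 1) (hLM : Disjoint L M)
    (hab : L.card ≤ M.card)
    (hchar : ringChar K = 0 ∨ (L.card : ℝ) ≤ c₀ * (ringChar K : ℝ) ^ 2)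
    (hquad : ∀ G : MvPolynomial (Fin 3) K, G ≠ 0 → G.totalDegree ≤ 2 →
      (L.filter fun ℓ => ∀ z ∈ ℓ, eval z G = 0).card < s ∨
      (M.filter fun m => ∀ z ∈ m, eval z G = 0).card < t)
    (IH : ∀ (L' M' : Finset (AffineSubspace K (Fin 3 → K))) (s' t' : ℕ),
      (∀ ℓ ∈ L', Module.finrank K ℓ.direction = 1) →
      (∀ m ∈ M', Module.finrank K m.direction = 1) → Disjoint L' M' →
      L'.card ≤ M'.card → L'.card + M'.card < L.card + M.card →
      (ringChar K = 0 ∨ (L'.card : ℝ) ≤ c₀ * (ringChar K : ℝ) ^ 2) →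
      (∀ G : MvPolynomial (Fin 3) K, G ≠ 0 → G.totalDegree ≤ 2 →
        (L'.filter fun ℓ => ∀ z ∈ ℓ, eval z G = 0).card < s' ∨
        (M'.filter fun m => ∀ z ∈ m, eval z G = 0).card < t') →
      ∀ I : Finset (Fin 3 → K), (∀ z ∈ I, (∃ ℓ ∈ L', z ∈ ℓ) ∧ (∃ m ∈ M', z ∈ m)) →
        (I.card : ℝ) ≤ C * Real.sqrt L'.card * M'.card + ((t' : ℝ) * L'.card + s' * M'.card))
    (I : Finset (Fin 3 → K)) (hI : ∀ z ∈ I, (∃ ℓ ∈ L, z ∈ ℓ) ∧ (∃ m ∈ M, z ∈ m)) :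
    (I.card : ℝ) ≤ C * Real.sqrt L.card * M.card + ((t : ℝ) * L.card + s * M.card) := by
  classical
  haveI : Infinite K := IsAlgClosed.instInfinite
  -- notation and signs
  set a := L.card with ha
  set b := M.card with hb
  have ha0 : (0 : ℝ) ≤ a := Nat.cast_nonneg _
  have hb0 : (0 : ℝ) ≤ b := Nat.cast_nonneg _
  have hs0 : (0 : ℝ) ≤ s := Nat.cast_nonneg _
  have ht0 : (0 : ℝ) ≤ t := Nat.cast_nonneg _
  set u := Real.sqrt a with hu
  have hu0 : 0 ≤ u := Real.sqrt_nonneg _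
  have hu2 : u ^ 2 = a := Real.sq_sqrt ha0
  have habR : (a : ℝ) ≤ b := by exact_mod_cast hab
  have hC0 : 0 < C := by linarith
  have hX0 : 0 ≤ u * b := mul_nonneg hu0 hb0
  have htriv : (I.card : ℝ) ≤ a * b := by
    exact_mod_cast card_le_card_mul_card L M hL hM hLM I hI
  /- the trivial case `a ≤ C²` -/
  by_cases hsmall : (a : ℝ) ≤ C ^ 2
  · have hua : u ≤ C := by
      rw [hu, ← Real.sqrt_sq hC0.le]
      exact Real.sqrt_le_sqrt hsmall
    have hab' : (a : ℝ) * b ≤ C * u * b := by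
      rw [← hu2]
      have h1 : u * u ≤ C * u := mul_le_mul_of_nonneg_right hua hu0
      have h2 := mul_le_mul_of_nonneg_right h1 hb0
      nlinarith [h2]
    nlinarith [mul_nonneg ht0 ha0, mul_nonneg hs0 hb0]
  /- the main case `a > C²` -/
  push Not at hsmall
  have hC2 : (10000000000 : ℝ) ≤ C ^ 2 := by nlinarith
  have hCu : C < u := (Real.lt_sqrt hC0.le).2 hsmall
  have hupos : 0 < u := hC0.trans hCu
  have hu1 : 1 ≤ u := by linarith
  have ha1 : (1 : ℝ) ≤ a := by linarith
  have hbpos : (0 : ℝ) < b := by linarith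
  -- the chosen lines through the points
  choose! ℓOf hℓOf hzℓOf using fun z (hz : z ∈ I) => (hI z hz).1
  choose! mOf hmOf hzmOf using fun z (hz : z ∈ I) => (hI z hz).2
  -- the points whose chosen `L`-line is `ℓ`, and their `M`-lines
  set Iℓ : AffineSubspace K (Fin 3 → K) → Finset (Fin 3 → K) :=
    fun ℓ => I.filter fun z => ℓOf z = ℓ with hIℓ
  have hIℓI : ∀ ℓ, Iℓ ℓ ⊆ I := fun ℓ => filter_subset _ _
  have hinj : ∀ ℓ ∈ L, Set.InjOn mOf ↑(Iℓ ℓ) := by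
    intro ℓ hℓ z hz z' hz' heq
    rw [hIℓ, coe_filter] at hz hz'
    obtain ⟨hzI, hzℓ⟩ := hz
    obtain ⟨hz'I, hz'ℓ⟩ := hz'
    have h1 : z ∈ ℓ := hzℓ ▸ hzℓOf z hzI
    have h2 : z' ∈ ℓ := hz'ℓ ▸ hzℓOf z' hz'I
    have hne : ℓ ≠ mOf z := fun h => disjoint_left.1 hLM hℓ (h ▸ hmOf z hzI)
    have hz'm : z' ∈ mOf z := by rw [heq]; exact hzmOf z' hz'I
    exact eq_of_mem_of_mem (hL ℓ hℓ) (hM _ (hmOf z hzI)) hne h1 (hzmOf z hzI) h2 hz'm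
  set Sℓ : AffineSubspace K (Fin 3 → K) → Finset (AffineSubspace K (Fin 3 → K)) :=
    fun ℓ => (Iℓ ℓ).image mOf with hSℓ
  have hSℓM : ∀ ℓ, Sℓ ℓ ⊆ M := by
    intro ℓ m hm
    obtain ⟨z, hz, rfl⟩ := mem_image.1 hm
    exact hmOf z (hIℓI ℓ hz)
  have hSℓcard : ∀ ℓ ∈ L, (Sℓ ℓ).card = (Iℓ ℓ).card := fun ℓ hℓ =>
    card_image_of_injOn (hinj ℓ hℓ)
  have hIℓb : ∀ ℓ ∈ L, ((Iℓ ℓ).card : ℝ) ≤ b := by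
    intro ℓ hℓ
    have : (Iℓ ℓ).card ≤ b := by rw [← hSℓcard ℓ hℓ]; exact card_le_card (hSℓM ℓ)
    exact_mod_cast this
  -- fibrewise counting over a set of lines
  have hfib : ∀ L' : Finset (AffineSubspace K (Fin 3 → K)), ∀ B : ℝ,
      (∀ ℓ ∈ L', ((Iℓ ℓ).card : ℝ) ≤ B) →
      (((I.filter fun z => ℓOf z ∈ L').card : ℝ)) ≤ L'.card * B := by
    intro L' B hB
    rw [card_eq_sum_card_fiberwise (f := ℓOf) (s := I.filter fun z => ℓOf z ∈ L') (t := L')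
      (fun z hz => (mem_filter.1 hz).2)]
    push_cast
    calc ∑ ℓ ∈ L', (((I.filter fun z => ℓOf z ∈ L').filter fun z => ℓOf z = ℓ).card : ℝ)
        ≤ ∑ ℓ ∈ L', ((Iℓ ℓ).card : ℝ) := by
          refine sum_le_sum fun ℓ _ => ?_
          exact_mod_cast card_le_card (filter_subset_filter _ (filter_subset _ _))
      _ ≤ ∑ ℓ ∈ L', B := sum_le_sum hB
      _ = L'.card * B := by rw [sum_const, nsmul_eq_mul]
  -- the threshold, the poor and the rich lines
  set A₁ : ℝ := C * b / (10 * u) with hA₁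
  have hA₁pos : 0 < A₁ := by
    rw [hA₁]
    exact div_pos (mul_pos hC0 hbpos) (mul_pos (by norm_num) hupos)
  set Lpoor := L.filter fun ℓ => ((Iℓ ℓ).card : ℝ) < A₁ with hLpoor
  set Lrich := L.filter fun ℓ => ¬ ((Iℓ ℓ).card : ℝ) < A₁ with hLrich
  -- the size of the sample
  set k := ⌈9600 * (a : ℝ) / C ^ 2⌉₊ with hk
  have hk_ge : 9600 * (a : ℝ) / C ^ 2 ≤ k := Nat.le_ceil _
  have hC2pos : (0 : ℝ) < C ^ 2 := pow_pos hC0 2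
  have hk_lt : (k : ℝ) < 9600 * (a : ℝ) / C ^ 2 + 1 :=
    Nat.ceil_lt_add_one (div_nonneg (mul_nonneg (by norm_num) ha0) hC2pos.le)
  have hk_ge' : 9600 * (a : ℝ) ≤ k * C ^ 2 := by
    rwa [div_le_iff₀ hC2pos] at hk_ge
  have h9600 : (9600 : ℝ) < 9600 * (a : ℝ) / C ^ 2 := by
    rw [lt_div_iff₀ hC2pos]
    linarith only [hsmall]
  have hk2R : (2 : ℝ) ≤ k := by linarith only [hk_ge, h9600]
  have hk2 : 2 ≤ k := by exact_mod_cast hk2R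
  have hkpos : (0 : ℝ) < k := by linarith only [hk2R]
  have hkaR : (k : ℝ) ≤ a := by
    have h1 : 9600 * (a : ℝ) / C ^ 2 ≤ a / 2 := by
      rw [div_le_iff₀ hC2pos]
      have hh := mul_le_mul_of_nonneg_left hC2 ha0
      linarith only [hh, ha0]
    have h2 : (2 : ℝ) ≤ a := by linarith only [hC2, hsmall]
    linarith only [hk_lt, h1, h2]
  have hkb : k ≤ b := by exact_mod_cast hkaR.trans habR
  -- sampling
  obtain ⟨T, hTM, hTk, hF⟩ := Literature.Combinatorics.Extremal.exists_subset_few_small M hk2 hkb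
    Lrich Sℓ (fun ℓ _ => hSℓM ℓ) (fun ℓ hℓ => by
      obtain ⟨hℓL, hrich⟩ := mem_filter.1 hℓ
      push Not at hrich
      rw [hSℓcard ℓ hℓL]
      have : (0 : ℝ) < (Iℓ ℓ).card := hA₁pos.trans_le hrich
      exact_mod_cast this)
  set F := Lrich.filter fun ℓ => 2 * M.card * (Sℓ ℓ ∩ T).card ≤ (Sℓ ℓ).card * k with hFdef
  set Lgood := Lrich.filter fun ℓ => ¬ 2 * M.card * (Sℓ ℓ ∩ T).card ≤ (Sℓ ℓ).card * k
    with hLgood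
  have hLgoodL : Lgood ⊆ L := (filter_subset _ _).trans (filter_subset _ _)
  have hLrich_a : (Lrich.card : ℝ) ≤ a := by exact_mod_cast card_le_card (filter_subset _ _)
  have hLpoor_a : (Lpoor.card : ℝ) ≤ a := by exact_mod_cast card_le_card (filter_subset _ _)
  have hLgood_a : (Lgood.card : ℝ) ≤ a := by exact_mod_cast card_le_card hLgoodL
  -- `|F| ≤ C √a / 240`
  set W : ℝ := u * b / C with hW
  have hWpos : 0 < W := by
    rw [hW]
    exact div_pos (mul_pos hupos hbpos) hC0
  have hA₁k : 960 * W ≤ A₁ * k := by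
    have h1 : A₁ * (9600 * (a : ℝ) / C ^ 2) = 960 * W := by
      rw [hA₁, hW, ← hu2]
      field_simp
      ring
    rw [← h1]
    exact mul_le_mul_of_nonneg_left hk_ge hA₁pos.le
  have hFcard : (F.card : ℝ) ≤ C * u / 240 := by
    refine hF.trans ?_
    have hterm : ∀ ℓ ∈ Lrich, 4 * (M.card : ℝ) / ((Sℓ ℓ).card * k) ≤ 4 * b / (A₁ * k) := by
      intro ℓ hℓ
      obtain ⟨hℓL, hrich⟩ := mem_filter.1 hℓ
      push Not at hrich
      rw [hSℓcard ℓ hℓL]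
      exact div_le_div_of_nonneg_left (mul_nonneg (by norm_num) hb0) (mul_pos hA₁pos hkpos)
        (mul_le_mul_of_nonneg_right hrich hkpos.le)
    calc ∑ ℓ ∈ Lrich, 4 * (M.card : ℝ) / ((Sℓ ℓ).card * k)
        ≤ ∑ ℓ ∈ Lrich, 4 * (b : ℝ) / (A₁ * k) := sum_le_sum hterm
      _ = Lrich.card * (4 * b / (A₁ * k)) := by rw [sum_const, nsmul_eq_mul]
      _ ≤ a * (4 * b / (A₁ * k)) := mul_le_mul_of_nonneg_right hLrich_a
          (div_nonneg (mul_nonneg (by norm_num) hb0) (mul_pos hA₁pos hkpos).le)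
      _ ≤ a * (4 * b / (960 * W)) := by
          refine mul_le_mul_of_nonneg_left ?_ ha0
          exact div_le_div_of_nonneg_left (mul_nonneg (by norm_num) hb0)
            (mul_pos (by norm_num) hWpos) hA₁k
      _ = C * u / 240 := by
          rw [hW, ← hu2]
          field_simp
          ring
  -- the sample surface
  have hparM : ∀ m ∈ M, ∃ uv : (Fin 3 → K) × (Fin 3 → K), uv.2 ≠ 0 ∧
      ∀ z, z ∈ m ↔ ∃ t : K, z = uv.1 + t • uv.2 := fun m hm => exists_param m (hM m hm)
  choose! uvM huvM0 huvM using hparM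
  obtain ⟨p, hp0, hpdeg, hpvan⟩ :=
    Literature.Combinatorics.Extremal.exists_surface_through_lines (T.image uvM)
  set D := Nat.sqrt (6 * k) with hD
  have hpD : p.totalDegree ≤ D :=
    hpdeg.trans (Nat.sqrt_le_sqrt (Nat.mul_le_mul_left 6 (card_image_le.trans hTk.le)))
  have hpT : ∀ m ∈ T, ∀ z ∈ m, eval z p = 0 := by
    intro m hm z hz
    obtain ⟨τ, rfl⟩ := (huvM m (hTM hm) z).1 hz
    have h := congrArg (Polynomial.eval τ) (hpvan _ (mem_image_of_mem uvM hm))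
    rwa [Literature.Combinatorics.Extremal.eval_aeval_line, Polynomial.eval_zero] at h
  -- `D ≤ 243 √a / C`
  have hD0 : (0 : ℝ) ≤ D := Nat.cast_nonneg _
  have hD2 : ((D : ℝ)) ^ 2 ≤ 6 * k := by
    have := Nat.sqrt_le' (6 * k)
    exact_mod_cast this
  have hDle : (D : ℝ) ≤ 243 * u / C := by
    have h1 : ((D : ℝ)) ^ 2 ≤ (243 * u / C) ^ 2 := by
      have e : (243 * u / C) ^ 2 = 59049 * a / C ^ 2 := by
        rw [div_pow, mul_pow, hu2]; norm_num
      rw [e]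
      have h6 : (6 : ℝ) ≤ 6 * a / C ^ 2 := by
        rw [le_div_iff₀ hC2pos]; linarith only [hsmall]
      calc ((D : ℝ)) ^ 2 ≤ 6 * k := hD2
        _ ≤ 6 * (9600 * a / C ^ 2 + 1) := by linarith only [hk_lt]
        _ = 57600 * a / C ^ 2 + 6 := by ring
        _ ≤ 57600 * a / C ^ 2 + 6 * a / C ^ 2 := by linarith only [h6]
        _ ≤ 59049 * a / C ^ 2 := by
            rw [← add_div, div_le_div_iff_of_pos_right hC2pos]
            linarith only [ha0]
    have h2 := Real.sqrt_le_sqrt h1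
    rwa [Real.sqrt_sq hD0, Real.sqrt_sq (div_nonneg (mul_nonneg (by norm_num) hu0) hC0.le)]
      at h2
  have hDu : (D : ℝ) ≤ u / 400 := by
    refine hDle.trans ?_
    rw [div_le_div_iff₀ hC0 (by norm_num)]
    have hh := mul_le_mul_of_nonneg_left hC5 hu0
    linarith only [hh, hu0]
  -- `D < p` in characteristic `p`
  have hDp : ringChar K = 0 ∨ D < ringChar K := by
    rcases hchar with h0 | hc
    · exact Or.inl h0
    · right
      have hp0 : (0 : ℝ) < ringChar K := by
        by_contra hle
        push Not at hle
        have h0 : (ringChar K : ℝ) = 0 := le_antisymm hle (Nat.cast_nonneg _)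
        rw [h0] at hc
        have : (a : ℝ) ≤ 0 := by simpa using hc
        linarith only [this, ha1]
      have hup : u ≤ Real.sqrt c₀ * ringChar K := by
        have h1 : u ≤ Real.sqrt (c₀ * (ringChar K : ℝ) ^ 2) := Real.sqrt_le_sqrt hc
        rwa [Real.sqrt_mul hc₀.le, Real.sqrt_sq hp0.le] at h1
      have hsc : 0 < Real.sqrt c₀ := Real.sqrt_pos.2 hc₀
      have hlt : (D : ℝ) < ringChar K := by
        calc (D : ℝ) ≤ 243 * u / C := hDle
          _ ≤ 243 * (Real.sqrt c₀ * ringChar K) / C :=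
              div_le_div_of_nonneg_right (mul_le_mul_of_nonneg_left hup (by norm_num)) hC0.le
          _ < ringChar K := by
              rw [div_lt_iff₀ hC0]
              calc 243 * (Real.sqrt c₀ * (ringChar K : ℝ))
                  = (243 * Real.sqrt c₀) * ringChar K := by ring
                _ < (250 * Real.sqrt c₀) * ringChar K :=
                    mul_lt_mul_of_pos_right (by linarith only [hsc]) hp0
                _ ≤ C * ringChar K := mul_le_mul_of_nonneg_right hCc hp0.le
                _ = ringChar K * C := mul_comm _ _
      exact_mod_cast hlt
  -- `39 D² < a + b`
  have hD39 : (39 : ℝ) * (D : ℝ) ^ 2 < (L.card : ℝ) + M.card := by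
    have h1 : ((D : ℝ)) ^ 2 ≤ (u / 400) ^ 2 := pow_le_pow_left₀ hD0 hDu 2
    have h2 : (u / 400) ^ 2 = a / 160000 := by rw [div_pow, hu2]; norm_num
    show (39 : ℝ) * (D : ℝ) ^ 2 < a + b
    rw [h2] at h1
    linarith only [h1, ha1, hb0]
  -- the good lines lie on the surface `{p = 0}`
  have hpgood : ∀ ℓ ∈ Lgood, ∀ z ∈ ℓ, eval z p = 0 := by
    intro ℓ hℓg
    obtain ⟨hℓrich, hgood⟩ := mem_filter.1 hℓg
    obtain ⟨hℓL, hrich⟩ := mem_filter.1 hℓrich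
    push Not at hrich hgood
    obtain ⟨uv, hv0, hmem⟩ := exists_param ℓ (hL ℓ hℓL)
    set Pℓ := (Iℓ ℓ).filter fun z => mOf z ∈ T with hPℓ
    have hPcard : Pℓ.card = (Sℓ ℓ ∩ T).card := by
      have himg : Sℓ ℓ ∩ T = Pℓ.image mOf := by
        ext m
        constructor
        · intro hm
          obtain ⟨hmS, hmT⟩ := mem_inter.1 hm
          obtain ⟨z, hz, rfl⟩ := mem_image.1 hmS
          exact mem_image.2 ⟨z, mem_filter.2 ⟨hz, hmT⟩, rfl⟩
        · intro hm
          obtain ⟨z, hz, rfl⟩ := mem_image.1 hm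
          obtain ⟨hzI, hzT⟩ := mem_filter.1 hz
          exact mem_inter.2 ⟨mem_image.2 ⟨z, hzI, rfl⟩, hzT⟩
      rw [himg, card_image_of_injOn ((hinj ℓ hℓL).mono (coe_subset.2 (filter_subset _ _)))]
    have hPgt : (D : ℝ) < Pℓ.card := by
      have h1 : A₁ * k < 2 * b * Pℓ.card := by
        have h2 : ((Sℓ ℓ).card : ℝ) * k < 2 * b * (Sℓ ℓ ∩ T).card := by exact_mod_cast hgood
        rw [← hPcard, hSℓcard ℓ hℓL] at h2
        calc A₁ * k ≤ ((Iℓ ℓ).card : ℝ) * k := mul_le_mul_of_nonneg_right hrich hkpos.le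
          _ < 2 * b * Pℓ.card := h2
      by_contra hle
      push Not at hle
      have h3 : (Pℓ.card : ℝ) ≤ 243 * u / C := hle.trans hDle
      have h4 : 2 * (b : ℝ) * Pℓ.card ≤ 2 * b * (243 * u / C) :=
        mul_le_mul_of_nonneg_left h3 (mul_nonneg (by norm_num) hb0)
      have h5 : 2 * (b : ℝ) * (243 * u / C) = 486 * W := by rw [hW]; ring
      linarith only [h1, h4, h5, hA₁k, hWpos]
    have hres : lineRes uv.1 uv.2 p = 0 := by
      by_contra hres
      have hle := card_le_totalDegree_of_lineRes_ne_zero hres Pℓ (fun z hz => by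
        obtain ⟨hzIℓ, hzT⟩ := mem_filter.1 hz
        obtain ⟨hzI, hzℓ⟩ := mem_filter.1 hzIℓ
        exact ⟨(hmem z).1 (hzℓ ▸ hzℓOf z hzI), hpT _ hzT z (hzmOf z hzI)⟩)
      have : (Pℓ.card : ℝ) ≤ D := by exact_mod_cast hle.trans hpD
      linarith only [this, hPgt]
    intro z hz
    obtain ⟨τ, rfl⟩ := (hmem z).1 hz
    exact eval_of_lineRes_eq_zero hres τ
  -- the component count for the points on good lines
  set I₀ := I.filter fun z => ℓOf z ∈ Lgood with hI₀
  have hI₀hyp : ∀ z ∈ I₀, (∃ ℓ ∈ Lgood, z ∈ ℓ) ∧ (∃ m ∈ M, z ∈ m) := by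
    intro z hz
    obtain ⟨hzI, hzg⟩ := mem_filter.1 hz
    exact ⟨⟨ℓOf z, hzg, hzℓOf z hzI⟩, mOf z, hmOf z hzI, hzmOf z hzI⟩
  have hG := componentBound_of_induction hC0.le L M s t D hL hM hLM hchar hquad hDp hD39 IH
  have hcount := card_le_of_componentBound' (C₁ := 244 * C) (C₂ := 3)
    (mul_nonneg (by norm_num) hC0.le) (by norm_num) L M s t D hG hL hM hLM hquad Lgood hLgoodL
    hp0 hpD hpgood I₀ hI₀hyp
  -- the poor and the failed parts
  set Ipoor := I.filter fun z => ℓOf z ∈ Lpoor with hIpoor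
  set IF := I.filter fun z => ℓOf z ∈ F with hIF
  have hcov : I ⊆ I₀ ∪ Ipoor ∪ IF := by
    intro z hz
    have hℓL := hℓOf z hz
    by_cases hp : ((Iℓ (ℓOf z)).card : ℝ) < A₁
    · exact mem_union_left _ (mem_union_right _ (mem_filter.2 ⟨hz, mem_filter.2 ⟨hℓL, hp⟩⟩))
    · have hr : ℓOf z ∈ Lrich := mem_filter.2 ⟨hℓL, hp⟩
      by_cases hf : 2 * M.card * (Sℓ (ℓOf z) ∩ T).card ≤ (Sℓ (ℓOf z)).card * k
      · exact mem_union_right _ (mem_filter.2 ⟨hz, mem_filter.2 ⟨hr, hf⟩⟩)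
      · exact mem_union_left _ (mem_union_left _ (mem_filter.2 ⟨hz, mem_filter.2 ⟨hr, hf⟩⟩))
  have hIpoor_le : (Ipoor.card : ℝ) ≤ a * A₁ :=
    (hfib Lpoor A₁ fun ℓ hℓ => (mem_filter.1 hℓ).2.le).trans
      (mul_le_mul_of_nonneg_right hLpoor_a hA₁pos.le)
  have hIF_le : (IF.card : ℝ) ≤ F.card * b :=
    hfib F b fun ℓ hℓ => hIℓb ℓ ((filter_subset _ _) ((filter_subset _ _) hℓ))
  -- assembling the estimate
  have hIle : (I.card : ℝ) ≤ I₀.card + Ipoor.card + IF.card := by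
    have := (card_le_card hcov).trans ((card_union_le _ _).trans
      (Nat.add_le_add_right (card_union_le _ _) _))
    exact_mod_cast this
  set X : ℝ := u * b with hX
  have e1 : (a : ℝ) * A₁ = C * X / 10 := by
    rw [hA₁, hX, ← hu2]
    field_simp
  have e2 : (F.card : ℝ) * b ≤ C * X / 240 := by
    calc (F.card : ℝ) * b ≤ (C * u / 240) * b := mul_le_mul_of_nonneg_right hFcard hb0
      _ = C * X / 240 := by rw [hX]; ring
  have e3 : (D : ℝ) * b ≤ X / 400 := by
    calc (D : ℝ) * b ≤ (u / 400) * b := mul_le_mul_of_nonneg_right hDu hb0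
      _ = X / 400 := by rw [hX]; ring
  have e4 : (D : ℝ) * Lgood.card ≤ X / 400 := by
    calc (D : ℝ) * Lgood.card ≤ D * b := mul_le_mul_of_nonneg_left (hLgood_a.trans habR) hD0
      _ ≤ X / 400 := e3
  have e5 : 244 * C * (D : ℝ) ^ 3 ≤ 2 / 5 * X := by
    have hD3 : (D : ℝ) ^ 3 ≤ (243 * u / C) ^ 3 := pow_le_pow_left₀ hD0 hDle 3
    have hu3 : u ^ 3 ≤ X := by
      calc u ^ 3 = u * a := by rw [← hu2]; ring
        _ ≤ u * b := mul_le_mul_of_nonneg_left habR hu0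
        _ = X := by rw [hX]
    have e : 244 * C * (243 * u / C) ^ 3 = (244 * 243 ^ 3 / C ^ 2) * u ^ 3 := by
      field_simp
    have hcoef : 244 * 243 ^ 3 / C ^ 2 ≤ (2 / 5 : ℝ) := by
      rw [div_le_iff₀ hC2pos]
      linarith only [hC2]
    calc 244 * C * (D : ℝ) ^ 3 ≤ 244 * C * (243 * u / C) ^ 3 :=
          mul_le_mul_of_nonneg_left hD3 (mul_nonneg (by norm_num) hC0.le)
      _ = (244 * 243 ^ 3 / C ^ 2) * u ^ 3 := e
      _ ≤ (2 / 5) * u ^ 3 := mul_le_mul_of_nonneg_right hcoef (pow_nonneg hu0 3)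
      _ ≤ 2 / 5 * X := by linarith only [hu3]
  have e6 : (b : ℝ) ≤ X := by
    calc (b : ℝ) = 1 * b := (one_mul _).symm
      _ ≤ u * b := mul_le_mul_of_nonneg_right hu1 hb0
      _ = X := by rw [hX]
  have e7 : (t : ℝ) * Lgood.card ≤ t * a := mul_le_mul_of_nonneg_left hLgood_a ht0
  have e8 : 100000 * X ≤ C * X := mul_le_mul_of_nonneg_right hC5 (by rw [hX]; exact hX0)
  have hX0' : 0 ≤ X := by rw [hX]; exact hX0
  have hgoal : C * u * (b : ℝ) = C * X := by rw [hX]; ring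
  rw [hgoal]
  linarith only [hcount, hIle, hIpoor_le, hIF_le, e1, e2, e3, e4, e5, e6, e7, e8, hX0', hs0,
    ht0, hb0, ha0]

end Step

/-! ### Lemma 3.1 by strong induction, and the discharge of the named fact -/

section Final

open scoped Classical in
/-- **de Zeeuw 2016, Lemma 3.1, over algebraically closed fields, with the explicit constant
`C = 10⁵ (√c₀ + 1)`**, by strong induction on `|L| + |M|` with the step
`lineIntersection_step`: `|I| ≤ C √|L| |M| + (t|L| + s|M|)`.
[cite: deZeeuw2016, Lemma 3.1] [cite: GuthKatz2015, §3 (induction on the number of lines)] -/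
theorem lineIntersection_closed_explicit {c₀ : ℝ} (hc₀ : 0 < c₀) (n : ℕ) :
    ∀ (K : Type) [Field K] [IsAlgClosed K] (L M : Finset (AffineSubspace K (Fin 3 → K)))
      (s t : ℕ),
      (∀ ℓ ∈ L, Module.finrank K ℓ.direction = 1) →
      (∀ m ∈ M, Module.finrank K m.direction = 1) →
      Disjoint L M → L.card ≤ M.card → L.card + M.card ≤ n →
      (ringChar K = 0 ∨ (L.card : ℝ) ≤ c₀ * (ringChar K : ℝ) ^ 2) →
      (∀ G : MvPolynomial (Fin 3) K, G ≠ 0 → G.totalDegree ≤ 2 →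
        (L.filter fun ℓ => ∀ z ∈ ℓ, eval z G = 0).card < s ∨
        (M.filter fun m => ∀ z ∈ m, eval z G = 0).card < t) →
      ∀ I : Finset (Fin 3 → K), (∀ z ∈ I, (∃ ℓ ∈ L, z ∈ ℓ) ∧ (∃ m ∈ M, z ∈ m)) →
        (I.card : ℝ) ≤ (100000 * (Real.sqrt c₀ + 1)) * Real.sqrt L.card * M.card +
          ((t : ℝ) * L.card + s * M.card) := by
  induction n using Nat.strong_induction_on with
  | _ n ihn =>
    intro K _ _ L M s t hL hM hLM hab hn hchar hquad I hI
    have hsc : 0 ≤ Real.sqrt c₀ := Real.sqrt_nonneg _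
    refine lineIntersection_step hc₀ (by nlinarith) (by nlinarith) L M s t hL hM hLM hab hchar
      hquad ?_ I hI
    intro L' M' s' t' hL' hM' hL'M' hab' hlt hchar' hquad' I' hI'
    exact ihn (L'.card + M'.card) (by omega) K L' M' s' t' hL' hM' hL'M' hab' le_rfl hchar'
      hquad' I' hI'

open scoped Classical in
/-- **de Zeeuw 2016, Lemma 3.1 (the bipartite Guth–Katz bound over algebraically closed fields)**
— exactly the hypothesis `H` of `rudnev_pointPlaneIncidence_of_lineIntersection_closed` and of
`stevensDeZeeuw_thm4_of_lineIntersection_closed`: for every `c₀ > 0` there is `C > 0` such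
that for finite disjoint families `L, M` of lines of `K³` (`K` algebraically closed) with
`|L| ≤ |M|`, `char K = 0` or `|L| ≤ c₀ (char K)²`, and no nonzero polynomial of degree `≤ 2`
vanishing on `s` lines of `L` and `t` lines of `M`, every finite set of points each lying on a
line of `L` and a line of `M` has at most `C (|L|^{1/2}|M| + t|L| + s|M|)` elements. Proved by
the Guth–Katz induction (`lineIntersection_closed_explicit`).
[cite: deZeeuw2016, Lemma 3.1] [cite: GuthKatz2015, §3] -/
theorem lineIntersection_closed : ∀ c₀ : ℝ, 0 < c₀ → ∃ C : ℝ, 0 < C ∧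
    ∀ (K : Type) [Field K] [IsAlgClosed K] (L M : Finset (AffineSubspace K (Fin 3 → K)))
      (s t : ℕ),
      (∀ ℓ ∈ L, Module.finrank K ℓ.direction = 1) →
      (∀ m ∈ M, Module.finrank K m.direction = 1) →
      Disjoint L M →
      L.card ≤ M.card →
      (ringChar K = 0 ∨ (L.card : ℝ) ≤ c₀ * (ringChar K : ℝ) ^ 2) →
      (∀ G : MvPolynomial (Fin 3) K, G ≠ 0 → G.totalDegree ≤ 2 →
        (L.filter fun ℓ => ∀ z ∈ ℓ, MvPolynomial.eval z G = 0).card < s ∨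
        (M.filter fun m => ∀ z ∈ m, MvPolynomial.eval z G = 0).card < t) →
      ∀ I : Finset (Fin 3 → K),
        (∀ z ∈ I, (∃ ℓ ∈ L, z ∈ ℓ) ∧ (∃ m ∈ M, z ∈ m)) →
        (I.card : ℝ) ≤ C * ((L.card : ℝ) ^ (1 / 2 : ℝ) * (M.card : ℝ)
          + (t : ℝ) * (L.card : ℝ) + (s : ℝ) * (M.card : ℝ)) := by
  intro c₀ hc₀
  refine ⟨100000 * (Real.sqrt c₀ + 1), by positivity, ?_⟩
  intro K _ _ L M s t hL hM hLM hab hchar hquad I hI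
  have h := lineIntersection_closed_explicit hc₀ (L.card + M.card) K L M s t hL hM hLM hab le_rfl
    hchar hquad I hI
  rw [Real.sqrt_eq_rpow (L.card : ℝ)] at h
  have hsc : 0 ≤ Real.sqrt c₀ := Real.sqrt_nonneg _
  have hC1 : (1 : ℝ) ≤ 100000 * (Real.sqrt c₀ + 1) := by nlinarith
  have hlin : 0 ≤ (t : ℝ) * L.card + s * M.card := by positivity
  have hlin' : (t : ℝ) * L.card + s * M.card ≤
      (100000 * (Real.sqrt c₀ + 1)) * ((t : ℝ) * L.card + s * M.card) := by
    calc (t : ℝ) * L.card + s * M.card = 1 * ((t : ℝ) * L.card + s * M.card) := (one_mul _).symm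
      _ ≤ (100000 * (Real.sqrt c₀ + 1)) * ((t : ℝ) * L.card + s * M.card) :=
          mul_le_mul_of_nonneg_right hC1 hlin
  calc (I.card : ℝ) ≤ (100000 * (Real.sqrt c₀ + 1)) * (L.card : ℝ) ^ (1 / 2 : ℝ) * M.card +
        ((t : ℝ) * L.card + s * M.card) := h
    _ ≤ (100000 * (Real.sqrt c₀ + 1)) * (L.card : ℝ) ^ (1 / 2 : ℝ) * M.card +
        (100000 * (Real.sqrt c₀ + 1)) * ((t : ℝ) * L.card + s * M.card) := by linarith
    _ = (100000 * (Real.sqrt c₀ + 1)) * ((L.card : ℝ) ^ (1 / 2 : ℝ) * (M.card : ℝ)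
          + (t : ℝ) * (L.card : ℝ) + (s : ℝ) * (M.card : ℝ)) := by ring

/-- **Stevens–de Zeeuw 2017, Theorem 4 — the named fact `stevensDeZeeuw_thm4` holds.** The
chain: Lemma 3.1 of [deZeeuw2016] over algebraically closed fields (`lineIntersection_closed`,
this file: Guth–Katz induction with degree reduction, elementary Monge–Salmon–Cayley theorem,
elementary structure of ruled surfaces) ⟹ Rudnev's point–plane bound
(`rudnev_pointPlaneIncidence_of_lineIntersection_closed`, de Zeeuw §§2, 4) ⟹ Theorem 4
(`stevensDeZeeuw_thm4_of_pointPlane`, Stevens–de Zeeuw §2).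
[cite: StevensDeZeeuw2017, Theorem 4] -/
theorem stevensDeZeeuw_thm4_holds : stevensDeZeeuw_thm4 :=
  stevensDeZeeuw_thm4_of_lineIntersection_closed lineIntersection_closed

end Final

end Literature.Combinatorics.Additive
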